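import Summits.ResolutionOfSingularities.ResolutionOfSingularities.Theorems.RisoStrataRisoCentresResolveCollapse
import Summits.ResolutionOfSingularities.ResolutionOfSingularities.Theses.RisoStrata

/-!
# Crux `RisoCentresResolve` (stmt-ResolutionOfSingularities-18546) — negative lemma modulo the construction
# `CollapsedTopLoop`: a presentation all of whose models are typed-rtd-collapsed and on which the constant
# word loops along some valuation refutes the crux

Route `ResolutionOfSingularities/RisoStrata`, crux `RisoCentresResolve` (Monreal Q1.6 in characteristic
`p`, `∃`-schedule form), lead c2 (line `Sketch`, cycle 2). This records, kernel-checked, WHAT A REFUTER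
MUST CONSTRUCT after the collapse theorem (`…Collapse.lean`, `rcr_collapse_route`): the hypothesis
`CollapsedTopLoop` is the existence of a prime `p`, an algebraically closed field `k` of characteristic
`p`, a presentation `K = k(hᵢ/hⱼ)` by `N + 1` nonzero elements, such that
* (COLLAPSE) every singular maximal ideal `m` of every `k`-subalgebra `B ⊆ K` has typed `rtd = 0`
  (`¬ Rtd B m 1`, the route's inline predicate) — as along purely inseparable singular families
  (`pcusp_not_rtd_one`); and
* (LOOP) for every length `L` there are a valuation ring `O ⊇ k`, a chart `k[hᵢ/hⱼ] ⊆ O` and admissible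
  denominators `x` for the constant word `0^L` (every letter is the same under collapse: the centre is
  the ideal of the reduced singular locus) whose stage-`L` local ring at the centre of `O` is NOT regular
  — i.e. iterated blow-up of the reduced singular locus does not uniformize all valuations in bounded
  time (by the quasi-compactness transfer of the line this is "top^∞ loops along some valuation").
Then `RisoCentresResolve` fails: the crux's schedule `sched` for this presentation has some length `L`;
by `rcr_collapse_route` its tower coincides with the `0^L`-tower, admissibility transfers
(`risoValid_iff_of_collapse`), and the crux's regularity contradicts LOOP.

`RisoCentresResolve_false_of_CollapsedTopLoop : CollapsedTopLoop → ¬ RisoCentresResolve`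
(`CollapsedTopLoop` is the `def` of this file, to be filed as a construction item). Where to look for the construction: SURFACE-PROBER.md / CHARP-ALPHABET.md in
`Cruxes/RisoCentresResolve/` (no collapsed top-loop is known: every toric variety of dimension ≤ 3 and
every non-toric hypersurface probed so far is resolved by the constant word; the toric fourfold `T` loops
but is not collapsed — its singular curves have rtd ≥ 1, `toricT_curve_rtd_one`). One `def … : Prop`
(the hypothesis); kernel-only.
-/

noncomputable section

set_option linter.dupNamespace false -- mandated namespace of this single-conjunct summit

namespace Summit.ResolutionOfSingularities.ResolutionOfSingularities.Theorems

open Summit.ResolutionOfSingularities.ResolutionOfSingularities.Theses.RisoStrata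

/-- **The construction a refuter must supply (`CollapsedTopLoop`).** A prime `p`, an algebraically
closed field `k` of characteristic `p` and a presentation `K = k(hᵢ/hⱼ)` such that (COLLAPSE) every
singular maximal ideal of every `k`-subalgebra of `K` has typed `rtd = 0` (`¬ Rtd B m 1`, route
predicate inline) and (LOOP) for every length `L` some valuation ring `O ⊇ k`, chart `k[hᵢ/hⱼ] ⊆ O` and
admissible denominators for the constant word `0^L` end, at stage `L`, in a NON-regular local ring at
the centre of `O`. -/
def CollapsedTopLoop : Prop := (∃ (p : ℕ) (_ : p.Prime) (k : Type) (_ : Field k) (_ : CharP k p) (_ : IsAlgClosed k) (K : Type) (_ : Field K) (_ : Algebra k K) (N : ℕ) (h : Fin (N + 1) → K), (∀ i, h i ≠ 0) ∧ IntermediateField.adjoin k (Set.range fun ij : Fin (N + 1) × Fin (N + 1) => h ij.1 * (h ij.2)⁻¹) = ⊤ ∧ (∀ (B : Subalgebra k K) (m : Ideal ↥B) (hm : m.IsMaximal), ¬ IsRegularLocalRing (Localization (@Ideal.primeCompl ↥B _ m hm.isPrime)) → ¬ (∃ (n : ℕ) (g : Fin n → ↥B), (∀ i, g i ∈ m) ∧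 Algebra.adjoin k (Set.range fun i => (g i : K)) = B ∧ ∃ W : Submodule k (Fin n → k), 1 ≤ Module.finrank k ↥W ∧ ∃ φ : {α : ↥B →ₐ[k] HahnSeries ℚ k // ∀ b ∈ m, 0 < (α b).orderTop} → (Fin n → HahnSeries ℚ k), (∀ a b : {α : ↥B →ₐ[k] HahnSeries ℚ k // ∀ b ∈ m, 0 < (α b).orderTop}, a ≠ b → ∃ j, ∀ i, (a.1 (g j) - b.1 (g j)).orderTop < ((φ a i - φ b i) - (a.1 (g i) - b.1 (g i))).orderTop) ∧ (∀ a i, 0 < (φ a i).orderTop) ∧ (∀ a, ∀ w : Fin n → HahnSeries ℚ k, (∀ i, 0 < (w i).orderTop) → w ∈ Submodule.span (HahnSeries ℚ k) ((fun u : Fin n → k => fun i => HahnSeries.C (u i)) '' (W : Set (Fin n → k))) → ∃ b, φ b = φ a + w))) ∧ (∀ L : ℕ, ∃ O : ValuationSubring K, (∀ c : k, algebraMap k K c ∈ O) ∧ ∃ j : Fin (N + 1), (∀ i, h i * (h j)⁻¹ ∈ O) ∧ ∃ x : ℕ → K, (∀ t, t < L → risoValid (fun (B : Subalgebra k K) (m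 : Ideal ↥B) (d : ℕ) => ¬ ∃ (n : ℕ) (g : Fin n → ↥B), (∀ i, g i ∈ m) ∧ Algebra.adjoin k (Set.range fun i => (g i : K)) = B ∧ ∃ W : Submodule k (Fin n → k), d + 1 ≤ Module.finrank k ↥W ∧ ∃ φ : {α : ↥B →ₐ[k] HahnSeries ℚ k // ∀ b ∈ m, 0 < (α b).orderTop} → (Fin n → HahnSeries ℚ k), (∀ a b : {α : ↥B →ₐ[k] HahnSeries ℚ k // ∀ b ∈ m, 0 < (α b).orderTop}, a ≠ b → ∃ j, ∀ i, (a.1 (g j) - b.1 (g j)).orderTop < ((φ a i - φ b i) - (a.1 (g i) - b.1 (g i))).orderTop) ∧ (∀ a i, 0 < (φ a i).orderTop) ∧ (∀ a, ∀ w : Fin n → HahnSeries ℚ k, (∀ i, 0 < (w i).orderTop) → w ∈ Submodule.span (HahnSeries ℚ k) ((fun u : Fin n → k => fun i => HahnSeries.C (u i)) '' (W : Set (Fin n → k))) → ∃ b, φ b = φ a + w)) O (risoStage (fun (B : Subalgebra k K) (m : Ideal ↥B) (d : ℕ) => ¬ ∃ (n : ℕ) (g : Fin n → ↥B), (∀ i,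 g i ∈ m) ∧ Algebra.adjoin k (Set.range fun i => (g i : K)) = B ∧ ∃ W : Submodule k (Fin n → k), d + 1 ≤ Module.finrank k ↥W ∧ ∃ φ : {α : ↥B →ₐ[k] HahnSeries ℚ k // ∀ b ∈ m, 0 < (α b).orderTop} → (Fin n → HahnSeries ℚ k), (∀ a b : {α : ↥B →ₐ[k] HahnSeries ℚ k // ∀ b ∈ m, 0 < (α b).orderTop}, a ≠ b → ∃ j, ∀ i, (a.1 (g j) - b.1 (g j)).orderTop < ((φ a i - φ b i) - (a.1 (g i) - b.1 (g i))).orderTop) ∧ (∀ a i, 0 < (φ a i).orderTop) ∧ (∀ a, ∀ w : Fin n → HahnSeries ℚ k, (∀ i, 0 < (w i).orderTop) → w ∈ Submodule.span (HahnSeries ℚ k) ((fun u : Fin n → k => fun i => HahnSeries.C (u i)) '' (W : Set (Fin n → k))) → ∃ b, φ b = φ a + w)) (Algebra.adjoin k (Set.range fun i => h i * (h j)⁻¹)) (List.replicate L 0) x t) 0 (x t)) ∧ ¬ IsRegularLocalRing ↥(risoLoc O (risoStage (fun (B : Subalgebra k K) (m : Ideal ↥B) (d : ℕ) => ¬ ∃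 (n : ℕ) (g : Fin n → ↥B), (∀ i, g i ∈ m) ∧ Algebra.adjoin k (Set.range fun i => (g i : K)) = B ∧ ∃ W : Submodule k (Fin n → k), d + 1 ≤ Module.finrank k ↥W ∧ ∃ φ : {α : ↥B →ₐ[k] HahnSeries ℚ k // ∀ b ∈ m, 0 < (α b).orderTop} → (Fin n → HahnSeries ℚ k), (∀ a b : {α : ↥B →ₐ[k] HahnSeries ℚ k // ∀ b ∈ m, 0 < (α b).orderTop}, a ≠ b → ∃ j, ∀ i, (a.1 (g j) - b.1 (g j)).orderTop < ((φ a i - φ b i) - (a.1 (g i) - b.1 (g i))).orderTop) ∧ (∀ a i, 0 < (φ a i).orderTop) ∧ (∀ a, ∀ w : Fin n → HahnSeries ℚ k, (∀ i, 0 < (w i).orderTop) → w ∈ Submodule.span (HahnSeries ℚ k) ((fun u : Fin n → k => fun i => HahnSeries.C (u i)) '' (W : Set (Fin n → k))) → ∃ b, φ b = φ a + w)) (Algebra.adjoin k (Set.range fun i => h i * (h j)⁻¹)) (List.replicate L 0) x L))))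

/-- **`CollapsedTopLoop → ¬ RisoCentresResolve`.** A typed-rtd-collapsed presentation on which the
constant word fails to uniformize some valuation within every bounded number of steps refutes the crux
(collapse theorem `rcr_collapse_route` / `risoStage_eq_of_collapse` + `risoValid_iff_of_collapse`).
[folklore] -/
theorem RisoCentresResolve_false_of_CollapsedTopLoop : CollapsedTopLoop → ¬ RisoCentresResolve := by
  rintro ⟨p, hp, k, _, _, _, K, _, _, N, h, hh, hgen, hcol, hloop⟩ hR
  have hs : RisoSchedule (fun (B : Subalgebra k K) (m : Ideal ↥B) (d : ℕ) => ¬ ∃ (n : ℕ) (g : Fin n → ↥B), (∀ i, g i ∈ m) ∧ Algebra.adjoin k (Set.range fun i => (g i : K)) = B ∧ ∃ W : Submodule k (Fin n → k), d + 1 ≤ Module.finrank k ↥W ∧ ∃ φ : {α : ↥B →ₐ[k] HahnSeries ℚ k // ∀ b ∈ m, 0 < (α b).orderTop} → (Fin n → HahnSeries ℚ k), (∀ a b : {α : ↥B →ₐ[k] HahnSeries ℚ k // ∀ b ∈ m, 0 < (α b).orderTop}, a ≠ b → ∃ j, ∀ i, (a.1 (g j) - b.1 (g j)).orderTop < ((φ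 a i - φ b i) - (a.1 (g i) - b.1 (g i))).orderTop) ∧ (∀ a i, 0 < (φ a i).orderTop) ∧ (∀ a, ∀ w : Fin n → HahnSeries ℚ k, (∀ i, 0 < (w i).orderTop) → w ∈ Submodule.span (HahnSeries ℚ k) ((fun u : Fin n → k => fun i => HahnSeries.C (u i)) '' (W : Set (Fin n → k))) → ∃ b, φ b = φ a + w)) N h := hR p hp k K N h hh hgen
  obtain ⟨sched, hsched⟩ := hs
  obtain ⟨O, hk, j, hj, x, hvalid, hnreg⟩ := hloop sched.length
  -- the cut holds at every singular maximal ideal for every letter (monotonicity of `Rtd` in `r`)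
  have hP : ∀ (B : Subalgebra k K) (m : Ideal ↥B) (hm : m.IsMaximal),
      ¬ IsRegularLocalRing (Localization (@Ideal.primeCompl ↥B _ m hm.isPrime)) → ∀ d : ℕ,
        (fun (B : Subalgebra k K) (m : Ideal ↥B) (d : ℕ) => ¬ ∃ (n : ℕ) (g : Fin n → ↥B), (∀ i, g i ∈ m) ∧ Algebra.adjoin k (Set.range fun i => (g i : K)) = B ∧ ∃ W : Submodule k (Fin n → k), d + 1 ≤ Module.finrank k ↥W ∧ ∃ φ : {α : ↥B →ₐ[k] HahnSeries ℚ k // ∀ b ∈ m, 0 < (α b).orderTop} → (Fin n → HahnSeries ℚ k), (∀ a b : {α : ↥B →ₐ[k] HahnSeries ℚ k // ∀ b ∈ m, 0 < (α b).orderTop}, a ≠ b → ∃ j, ∀ i, (a.1 (g j) - b.1 (g j)).orderTop < ((φ a i - φ b i) - (a.1 (g i) - b.1 (g i))).orderTop) ∧ (∀ a i, 0 < (φ a i).orderTop) ∧ (∀ a, ∀ w : Fin n → HahnSeries ℚ k, (∀ i, 0 < (w i).orderTop) → w ∈ Submodule.span (HahnSeries ℚ k) ((fun u : Fin n → k =>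 fun i => HahnSeries.C (u i)) '' (W : Set (Fin n → k))) → ∃ b, φ b = φ a + w)) B m d := by
    intro B m hm hreg d
    rintro ⟨n, g, hg, hgen', W, hW, φ, h1, h2, h3⟩
    exact hcol B m hm hreg ⟨n, g, hg, hgen', W, le_trans (Nat.le_add_left 1 d) hW, φ, h1, h2, h3⟩
  have key : ∀ t, t ≤ sched.length →
      risoStage (fun (B : Subalgebra k K) (m : Ideal ↥B) (d : ℕ) => ¬ ∃ (n : ℕ) (g : Fin n → ↥B), (∀ i, g i ∈ m) ∧ Algebra.adjoin k (Set.range fun i => (g i : K)) = B ∧ ∃ W : Submodule k (Fin n → k), d + 1 ≤ Module.finrank k ↥W ∧ ∃ φ : {α : ↥B →ₐ[k] HahnSeries ℚ k // ∀ b ∈ m, 0 < (α b).orderTop} → (Fin n → HahnSeries ℚ k), (∀ a b : {α : ↥B →ₐ[k] HahnSeries ℚ k // ∀ b ∈ m, 0 < (α b).orderTop}, a ≠ b → ∃ j, ∀ i, (a.1 (g j) - b.1 (g j)).orderTop < ((φ a i - φ b i) - (a.1 (g i) - b.1 (g i))).orderTop) ∧ (∀ a i, 0 < (φ a i).orderTop)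 ∧ (∀ a, ∀ w : Fin n → HahnSeries ℚ k, (∀ i, 0 < (w i).orderTop) → w ∈ Submodule.span (HahnSeries ℚ k) ((fun u : Fin n → k => fun i => HahnSeries.C (u i)) '' (W : Set (Fin n → k))) → ∃ b, φ b = φ a + w)) (Algebra.adjoin k (Set.range fun i => h i * (h j)⁻¹)) sched x t =
        risoStage (fun (B : Subalgebra k K) (m : Ideal ↥B) (d : ℕ) => ¬ ∃ (n : ℕ) (g : Fin n → ↥B), (∀ i, g i ∈ m) ∧ Algebra.adjoin k (Set.range fun i => (g i : K)) = B ∧ ∃ W : Submodule k (Fin n → k), d + 1 ≤ Module.finrank k ↥W ∧ ∃ φ : {α : ↥B →ₐ[k] HahnSeries ℚ k // ∀ b ∈ m, 0 < (α b).orderTop} → (Fin n → HahnSeries ℚ k), (∀ a b : {α : ↥B →ₐ[k] HahnSeries ℚ k // ∀ b ∈ m, 0 < (α b).orderTop}, a ≠ b → ∃ j, ∀ i, (a.1 (g j) - b.1 (g j)).orderTop < ((φ a i - φ b i) - (a.1 (g i) - b.1 (g i))).orderTop) ∧ (∀ a i, 0 < (φ a i).orderTop) ∧ (∀ a, ∀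 w : Fin n → HahnSeries ℚ k, (∀ i, 0 < (w i).orderTop) → w ∈ Submodule.span (HahnSeries ℚ k) ((fun u : Fin n → k => fun i => HahnSeries.C (u i)) '' (W : Set (Fin n → k))) → ∃ b, φ b = φ a + w)) (Algebra.adjoin k (Set.range fun i => h i * (h j)⁻¹))
          (List.replicate sched.length 0) x t := fun t ht =>
    risoStage_eq_of_collapse _ hP _ sched (List.replicate sched.length 0) x ht
      (by rw [List.length_replicate]; exact ht)
  apply hnreg
  rw [← key sched.length le_rfl]
  apply hsched O hk j hj x
  intro t ht
  rw [key t ht.le, risoValid_iff_of_collapse _ O _ (hP _) (sched.getD t 0) 0 (x t)]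
  exact hvalid t ht

end Summit.ResolutionOfSingularities.ResolutionOfSingularities.Theorems

end
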